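import Summits.QuantumAdvantage.QuantumAdvantage.Theorems.CubicForrelationNearExactIsExactTwelveLevelFive932Structure
import Summits.QuantumAdvantage.QuantumAdvantage.Theorems.CubicForrelationNearExactIsExactTwelveQuadSpectrumB
import Summits.QuantumAdvantage.QuantumAdvantage.Theorems.CubicForrelationNearExactIsExactTwelveTypeO896Dead
import Summits.QuantumAdvantage.QuantumAdvantage.Theorems.CubicForrelationNearExactIsExactTwelveTypeO960Partner

/-!
# Crux `CubicForrelation.NearExactIsExact` (stmt-QuantumAdvantage-14043) — n = 12: NO level-5 side at `Φ ≥ 233/256 = 932/1024`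
  (the boundary case of `tw15_levelFive_932_false` is dead)

Certificate seat `b2b-cforr-cert` (gen 18).  HONEST FRAMING: a kernel-checked THEOREM (standard axioms) about cubic Boolean pairs on 12 bits —
one of the two configurations left for the single undecided value `932/1024` above the record at `n = 12`; it does NOT produce a new value of
`θ₁₂` (the (type O, base 960) × (level ≥ 6) configuration remains, dead only modulo Kasami–Tokura's normal form); NOT summit progress.

THEOREM `tw19_levelFive_932_false`: cubic `f, g : 𝔽₂¹² → 𝔽₂` with `W_g = 32·u'`, some `u'(x)` odd, and `Φ(f,g) ≥ 932/1024` do not exist.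
Proof.  (1) `tw19_levelFive_932_structure`: `u' = 2(−1)^f + σ(1_P − 16·1_T)`, `P` the odd hyperplane `{(−1)^{γ·x} = t}`, `σ = (−1)^D` with `D`
quadratic, `#T = 4`.  (2) The partner `f` is not type O (`to18_typeO_ge932_E960` + `to18_typeO_E960_partner_even` for `(g, f)` would put `g`
at level `≥ 6`), so `W_f = 32k` with `[k odd]` AFFINE (`stub_walshTower`).  (3) Walsh inversion of `W_g = 64(−1)^f + 32e` gives
`ê(y) = 128(−1)^{g(y)} − 64k(y)` with `ê = Ŝ − 16·T̂`, `Ŝ(y) = Σ_{x∈P} σ(x)(−1)^{x·y} = 64·m(y)` (`qs_hyperplane_sum_parity`) and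
`T̂(y) = Σ_{x∈T} σ(x)(−1)^{x·y}`; hence `T̂ = 4K`, `K = m − 2(−1)^g + k ∈ {0, ±1}` (`|T̂| ≤ 4`), and Parseval `Σ T̂² = 4·4096` makes `K ≠ 0` at
EXACTLY `1024` points.  (4) If every `m(y)` is even, `{k odd} = {K ≠ 0}` has `1024` points — not `0`, `2048` or `4096`: contradiction.  Otherwise
`|m| ≤ 2` and `{m odd} = {h ⊕ h(· ⊕ γ) = c}` with `h` quadratic: if `k` is odd somewhere, `f` is itself a level-5 side of `(g, f)` and (1) for
`(g, f)` produces a point with `|k − 2(−1)^g| = 15`, but `k − 2(−1)^g = K − m ∈ [−3, 3]`; if `k` is even everywhere, `{K ≠ 0} = {m odd}` is the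
support (or co-support) of the AFFINE function `h ⊕ h(· ⊕ γ)` (`stub_derivDegree`), again of size `1024`: contradiction.

References: J. Ax (1964) / R. J. McEliece (1972); O. S. Rothaus (1976); MacWilliams–Sloane (1977) Ch. 13 §3, Ch. 14 §5, Ch. 15 §2; C. Carlet (2021)
§4.1, §5.2, §6.1.  Everything below is proved from Mathlib and the tree; axioms are the standard three.
-/

set_option linter.dupNamespace false -- D-0017: single-problem summit ⇒ `QuantumAdvantage.QuantumAdvantage` by design

noncomputable section

namespace Summit.QuantumAdvantage.QuantumAdvantage.Theorems.CubicForrelation.NearExactIsExact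

open Finset
open Literature.Computability.QuantumComplexity
open Literature.Computability.QuantumComplexity.BuzetChailloux (bxor zeroVec bxor_comm twist_zeroVec_right twist_bxor_right)
open Literature.Computability.QuantumComplexity.DerivativeWalsh (W sum_W_sq)
open Literature.Computability.QuantumComplexity.Simon (twist_eq_one_or)

/-! ### Supports of affine functions on 12 bits -/

/-- The support of an affine Boolean function on 12 bits has `0`, `2048` or `4096` points. [folklore] -/
theorem l5d_affine_card (a : (Fin (6 + 6) → Bool) → Bool) (ha : IsDegLeFun 1 a) :
    #(univ.filter fun y => a y = true) = 0 ∨ #(univ.filter fun y => a y = true) = 2048 ∨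
      #(univ.filter fun y => a y = true) = 4096 := by
  classical
  obtain ⟨c, b, hcb⟩ := stub_affineForm (6 + 6) a ha
  have hsb : signOf b = 1 ∨ signOf b = -1 := by cases b <;> simp [signOf]
  have hiff : ∀ y, a y = true ↔ twist c y = -signOf b := by
    intro y
    have h1 := hcb y
    constructor
    · intro hy
      rw [hy] at h1
      simp only [signOf] at h1 ⊢
      rcases twist_eq_one_or c y with h | h <;> cases b <;> simp_all
    · intro hy
      rw [hy] at h1
      cases hay : a y
      · rw [hay] at h1; rcases hsb with hs | hs <;> rw [hs] at h1 <;> norm_num [signOf] at h1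
      · rfl
  by_cases hc : c = zeroVec
  · have hconst : ∀ y, twist c y = 1 := fun y => by rw [hc, twist_comm, twist_zeroVec_right]
    rcases hsb with hs | hs
    · left
      rw [card_eq_zero, filter_eq_empty_iff]
      intro y _ hy
      have := (hiff y).1 hy
      rw [hconst y, hs] at this
      norm_num at this
    · right; right
      have e : (univ.filter fun y : Fin (6 + 6) → Bool => a y = true) = univ :=
        filter_true_of_mem fun y _ => (hiff y).2 (by rw [hconst y, hs]; norm_num)
      rw [e, card_univ, Fintype.card_fun, Fintype.card_bool, Fintype.card_fin]; norm_num
  · right; left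
    have e : (univ.filter fun y : Fin (6 + 6) → Bool => a y = true) = univ.filter fun y => twist c y = -signOf b :=
      filter_congr fun y _ => hiff y
    rw [e]
    exact tw59_card_half c hc (-signOf b) (by rcases hsb with hs | hs <;> rw [hs] <;> norm_num)

/-! ### The theorem -/

/-- **No level-5 side at `Φ ≥ 932/1024` on 12 bits.**  Cubic `f, g : 𝔽₂¹² → 𝔽₂` with `W_g = 32·u'`, some `u'(x)` odd and
`Φ(f,g) ≥ 233/256 = 932/1024` cannot exist (see the module docstring for the proof).  Finite-slice statement; no new value of `θ₁₂`;
NOT summit progress. [this work] -/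
theorem tw19_levelFive_932_false (f g : (Fin (6 + 6) → Bool) → Bool) (hf : IsDegLeFun 3 f) (hg : IsDegLeFun 3 g)
    (u' : (Fin (6 + 6) → Bool) → ℤ) (hu' : ∀ x, W (fun y => signOf (g y)) x = (2 : ℝ) ^ 5 * (u' x : ℝ))
    (hodd : ∃ x, Odd (u' x)) (hΦ : (932 / 1024 : ℝ) ≤ forrelation f g) : False := by
  classical
  -- (1) structure of the level-5 side; `Ŝ = 64 m` for the quadratic sign pattern on the odd hyperplane
  obtain ⟨γ, tg, D, T, htg, hγ0, hPg, hD, hTcard, hTodd, hoff, hflat, hspike⟩ :=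
    tw19_levelFive_932_structure f g hf hg u' hu' hodd hΦ
  obtain ⟨m, hm, hdich⟩ := qs_hyperplane_sum_parity D hD γ tg htg
  set P := univ.filter (fun x : Fin (6 + 6) → Bool => twist γ x = tg) with hPdef
  have hmemP : ∀ x, x ∈ P ↔ Odd (u' x) := fun x => by rw [hPdef, mem_filter, ← hPg]; simp
  have hTP : T ⊆ P := fun x hx => (hmemP x).2 (hTodd x hx)
  -- (2) the partner is not type O: `W_f = 32 k`, `[k odd]` affine
  have hΦ' : forrelation g f = forrelation f g := by
    rw [Summit.QuantumAdvantage.QuantumAdvantage.Theorems.SignedCubicForrelationNotPrBPP.Negative.HalfQuad.forrelation_comm]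
  have hΦ'' : (932 / 1024 : ℝ) ≤ forrelation g f := by rw [hΦ']; exact hΦ
  obtain ⟨uf, huf⟩ := tw_base (n := 6 + 6) f hf 4 (by norm_num)
  have hug : ∀ x, W (fun y => signOf (g y)) x = (2 : ℝ) ^ 4 * (((2 * u' x : ℤ)) : ℝ) := fun x => by
    rw [hu' x]; push_cast; ring
  have hfev : ∀ y, ¬ Odd (uf y) := by
    intro y hy
    have hE := to18_typeO_ge932_E960 g f hg hf uf huf ⟨y, hy⟩ hΦ''
    have h := (to18_typeO_E960_partner_even g f hf uf huf ⟨y, hy⟩ hE hΦ'' (fun x => 2 * u' x) hug).2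
    obtain ⟨x₀, hx₀⟩ := hodd
    exact h x₀ (by rw [Int.mul_ediv_cancel_left _ two_ne_zero]; exact hx₀)
  set k : (Fin (6 + 6) → Bool) → ℤ := fun y => uf y / 2 with hkdef
  have hk : ∀ y, W (fun x => signOf (f x)) y = (2 : ℝ) ^ 5 * (k y : ℝ) := fun y => by rw [tw_level_up f uf huf hfev y]
  have hℓ : IsDegLeFun 1 (fun y => decide (Odd (k y))) :=
    stub_walshTower stub_axParity (6 + 6) 5 1 f k hf hk (by intro j hj hjn; omega)
  -- (3) Walsh inversion: `ê(y) = 128 (−1)^{g(y)} − 64 k(y)` for `e = u' − 2(−1)^f`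
  have hinv : ∀ y, ∑ x, ((u' x - 2 * sZ (f x) : ℤ) : ℝ) * twist x y = 128 * signOf (g y) - 64 * (k y : ℝ) := by
    intro y
    have h := tz_inversion (fun y => signOf (g y)) y
    rw [sum_congr rfl fun x _ => by rw [hu' x]] at h
    have h2 : ∑ x, ((u' x - 2 * sZ (f x) : ℤ) : ℝ) * twist x y =
        ∑ x, (u' x : ℝ) * twist x y - 2 * W (fun x => signOf (f x)) y := by
      unfold W
      rw [mul_sum, ← sum_sub_distrib]
      refine sum_congr rfl fun x _ => ?_
      push_cast; rw [tp_sZ_cast]; ring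
    have h3 : ∑ x, (u' x : ℝ) * twist x y = 128 * signOf (g y) := by
      have h4 : (2 : ℝ) ^ 5 * ∑ x, (u' x : ℝ) * twist x y = 2 ^ (6 + 6) * signOf (g y) := by
        rw [mul_sum, ← h]; exact sum_congr rfl fun x _ => by ring
      have e : (2 : ℝ) ^ (6 + 6) = 2 ^ 5 * 128 := by norm_num
      rw [e, mul_assoc] at h4
      exact mul_left_cancel₀ (by positivity) h4
    rw [h2, h3, hk y]; ring
  -- (4) `ê = Ŝ − 16·T̂` from the structure
  have he : ∀ x, ((u' x - 2 * sZ (f x) : ℤ) : ℝ) =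
      (if x ∈ P then (sZ (D x) : ℝ) else 0) - 16 * (if x ∈ T then (sZ (D x) : ℝ) else 0) := by
    intro x
    by_cases hxP : x ∈ P
    · by_cases hxT : x ∈ T
      · rw [if_pos hxP, if_pos hxT, hspike x hxT]; push_cast; ring
      · rw [if_pos hxP, if_neg hxT, hflat x ((hmemP x).1 hxP) hxT]; push_cast; ring
    · have hxT : x ∉ T := fun h => hxP (hTP h)
      rw [if_neg hxP, if_neg hxT, hoff x (fun h => hxP ((hmemP x).2 h))]; push_cast; ring
  have hsplit : ∀ y, ∑ x, ((u' x - 2 * sZ (f x) : ℤ) : ℝ) * twist x y =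
      (∑ x ∈ P, (sZ (D x) : ℝ) * twist x y) - 16 * ∑ x ∈ T, (sZ (D x) : ℝ) * twist x y := by
    intro y
    have e1 : ∀ x, ((if x ∈ P then (sZ (D x) : ℝ) else 0) - 16 * (if x ∈ T then (sZ (D x) : ℝ) else 0)) * twist x y =
        (if x ∈ P then (sZ (D x) : ℝ) * twist x y else 0) - 16 * (if x ∈ T then (sZ (D x) : ℝ) * twist x y else 0) := by
      intro x; split_ifs <;> ring
    rw [sum_congr rfl fun x _ => by rw [he x, e1 x], sum_sub_distrib, ← mul_sum, sum_ite_mem, sum_ite_mem, univ_inter,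
      univ_inter]
  have hsZabs : ∀ b : Bool, |((sZ b : ℤ) : ℝ)| = 1 := fun b => by rcases tp_sZ_cases b with h | h <;> rw [h] <;> norm_num
  have hTh_le : ∀ y, |∑ x ∈ T, (sZ (D x) : ℝ) * twist x y| ≤ 4 := by
    intro y
    calc |∑ x ∈ T, (sZ (D x) : ℝ) * twist x y| ≤ ∑ x ∈ T, |(sZ (D x) : ℝ) * twist x y| := abs_sum_le_sum_abs _ _
      _ = ∑ x ∈ T, (1 : ℝ) := sum_congr rfl fun x _ => by rw [abs_mul, abs_twist, hsZabs, mul_one]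
      _ = 4 := by rw [sum_const, hTcard]; norm_num
  have hParsT : ∑ y, (∑ x ∈ T, (sZ (D x) : ℝ) * twist x y) ^ 2 = 16384 := by
    have h := sum_W_sq (fun x => if x ∈ T then (sZ (D x) : ℝ) else 0)
    have eW : ∀ y, W (fun x => if x ∈ T then (sZ (D x) : ℝ) else 0) y = ∑ x ∈ T, (sZ (D x) : ℝ) * twist x y := by
      intro y
      unfold W
      rw [sum_congr rfl fun x _ => by rw [ite_mul, zero_mul], sum_ite_mem, univ_inter]
    have esq : ∀ x, (if x ∈ T then (sZ (D x) : ℝ) else 0) ^ 2 = if x ∈ T then (1 : ℝ) else 0 := by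
      intro x
      split_ifs with hx
      · rw [← sq_abs, hsZabs]; norm_num
      · ring
    rw [sum_congr rfl fun y _ => by rw [eW y], sum_congr rfl fun x _ => esq x, sum_ite_mem, univ_inter, sum_const, hTcard] at h
    rw [h]; norm_num
  -- (5) `T̂ = 4K` with `K = m − 2(−1)^g + k ∈ {0, ±1}`, and `#{K ≠ 0} = 1024`
  set Th : (Fin (6 + 6) → Bool) → ℝ := fun y => ∑ x ∈ T, (sZ (D x) : ℝ) * twist x y with hTh
  set K : (Fin (6 + 6) → Bool) → ℤ := fun y => m y - 2 * sZ (g y) + k y with hKdef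
  have hK : ∀ y, Th y = 4 * ((K y : ℤ) : ℝ) := by
    intro y
    have h1 := hinv y
    rw [hsplit y, hm y] at h1
    show Th y = 4 * (((m y - 2 * sZ (g y) + k y : ℤ)) : ℝ)
    push_cast; rw [tp_sZ_cast]; linarith
  have hKval : ∀ y, K y = 0 ∨ K y = 1 ∨ K y = -1 := by
    intro y
    have h1 : |Th y| ≤ 4 := hTh_le y
    rw [hK y, abs_mul] at h1
    norm_num at h1
    have h2 : |K y| ≤ 1 := by exact_mod_cast h1
    rw [abs_le] at h2
    omega
  have hAcard : #(univ.filter fun y : Fin (6 + 6) → Bool => K y ≠ 0) = 1024 := by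
    have hKsq : ∀ y, ((K y : ℤ) : ℝ) ^ 2 = if K y ≠ 0 then (1 : ℝ) else 0 := by
      intro y
      rcases hKval y with h | h | h <;> rw [h] <;> norm_num
    have hParsT' : ∑ y, Th y ^ 2 = 16384 := hParsT
    have h1 : ∑ y, Th y ^ 2 = 16 * ∑ y, ((K y : ℤ) : ℝ) ^ 2 := by
      rw [mul_sum]; exact sum_congr rfl fun y _ => by rw [hK y]; ring
    rw [hParsT', sum_congr rfl fun y _ => hKsq y, sum_boole] at h1
    have h2 : (#(univ.filter fun y : Fin (6 + 6) → Bool => K y ≠ 0) : ℝ) = 1024 := by linarith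
    exact_mod_cast h2
  -- parity bookkeeping: `k = K − m + 2(−1)^g`, `[K odd] = [K ≠ 0]`
  have hkK : ∀ y, Odd (k y) ↔ Odd (K y - m y) := by
    intro y
    have e : k y = K y - m y + 2 * sZ (g y) := by
      show k y = (m y - 2 * sZ (g y) + k y) - m y + 2 * sZ (g y); ring
    rw [e, Int.odd_add]
    exact ⟨fun h => h.2 ⟨sZ (g y), two_mul _⟩, fun h => ⟨fun _ => ⟨sZ (g y), two_mul _⟩, fun _ => h⟩⟩
  have hKodd : ∀ y, Odd (K y) ↔ K y ≠ 0 := by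
    intro y; rcases hKval y with h0 | h0 | h0 <;> rw [h0] <;> decide
  -- (6) the dichotomy
  rcases hdich with hev | ⟨hm2, h, c, hh, hpar⟩
  · /- every `m(y)` even: `{k odd} = {K ≠ 0}` has `1024` points, impossible for an affine parity -/
    have hiff : ∀ y, Odd (k y) ↔ K y ≠ 0 := by
      intro y
      rw [hkK y, Int.odd_sub, ← hKodd y]
      exact ⟨fun h' => h'.2 (hev y), fun h' => ⟨fun _ => hev y, fun _ => h'⟩⟩
    have e : (univ.filter fun y : Fin (6 + 6) → Bool => decide (Odd (k y)) = true) = univ.filter fun y => K y ≠ 0 :=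
      filter_congr fun y _ => by rw [decide_eq_true_iff, hiff]
    have h := l5d_affine_card _ hℓ
    rw [e, hAcard] at h
    norm_num at h
  · by_cases hkodd : ∃ y, Odd (k y)
    · /- `f` is itself a level-5 side of `(g, f)`: a spike `|k − 2(−1)^g| = 15`, but `k − 2(−1)^g = K − m ∈ [−3, 3]` -/
      obtain ⟨γf, tf, Df, Tf, -, -, -, -, hTfcard, -, -, -, hspf⟩ :=
        tw19_levelFive_932_structure g f hg hf k hk hkodd hΦ''
      obtain ⟨y₀, hy₀⟩ : Tf.Nonempty := card_pos.1 (by rw [hTfcard]; norm_num)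
      have h1 := hspf y₀ hy₀
      have e : k y₀ - 2 * sZ (g y₀) = K y₀ - m y₀ := by
        show k y₀ - 2 * sZ (g y₀) = (m y₀ - 2 * sZ (g y₀) + k y₀) - m y₀; ring
      have hm' := hm2 y₀
      rw [abs_le] at hm'
      rcases hKval y₀ with h0 | h0 | h0 <;> rcases tp_sZ_cases (Df y₀) with hs | hs <;> rcases tp_sZ_cases (g y₀) with hs' | hs' <;>
        · rw [h0] at e; rw [hs, hs'] at h1; rw [hs'] at e; omega
    · /- `f` at level `≥ 6`: `k` even, `{K ≠ 0} = {m odd} = {h ⊕ h(· ⊕ γ) = c}` has `1024` points, but `h ⊕ h(· ⊕ γ)` is affine -/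
      push Not at hkodd
      have hiff : ∀ y, K y ≠ 0 ↔ (h y ^^ h (bxor y γ)) = c := by
        intro y
        rw [← hpar y, ← hKodd y]
        have h1 : ¬ Odd (K y - m y) := fun h' => hkodd y ((hkK y).2 h')
        rw [Int.odd_sub] at h1
        constructor
        · intro hK'
          by_contra hmo
          exact h1 ⟨fun _ => Int.not_odd_iff_even.1 hmo, fun _ => hK'⟩
        · intro hmo
          by_contra hK'
          exact h1 ⟨fun hK'' => absurd hK'' hK', fun hme => absurd hmo (Int.not_odd_iff_even.2 hme)⟩
      have hderiv : IsDegLeFun 1 (fun y => h y ^^ h (bxor y γ)) := stub_derivDegree (6 + 6) 1 h γ hh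
      cases c with
      | true =>
        have e : (univ.filter fun y : Fin (6 + 6) → Bool => (h y ^^ h (bxor y γ)) = true) = univ.filter fun y => K y ≠ 0 :=
          filter_congr fun y _ => (hiff y).symm
        have h2 := l5d_affine_card _ hderiv
        rw [e, hAcard] at h2
        norm_num at h2
      | false =>
        have hderiv' : IsDegLeFun 1 (fun y => (h y ^^ h (bxor y γ)) ^^ true) := tb_isDegLeFun_xor_const hderiv true
        have e : (univ.filter fun y : Fin (6 + 6) → Bool => ((h y ^^ h (bxor y γ)) ^^ true) = true) =
            univ.filter fun y => K y ≠ 0 :=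
          filter_congr fun y _ => by rw [hiff y]; cases (h y ^^ h (bxor y γ)) <;> simp
        have h2 := l5d_affine_card _ hderiv'
        rw [e, hAcard] at h2
        norm_num at h2

/-- **Packaging at `Fin 12`**: no cubic pair on 12 bits with `W_g = 32u'`, `u'` odd somewhere, has `Φ ≥ 233/256`. [this work] -/
theorem levelFive_932le_false_twelve : ∀ f g : (Fin 12 → Bool) → Bool, IsDegLeFun 3 f → IsDegLeFun 3 g →
    ∀ u' : (Fin 12 → Bool) → ℤ, (∀ x, W (fun y => signOf (g y)) x = 32 * (u' x : ℝ)) → (∃ x, Odd (u' x)) →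
    (233 / 256 : ℝ) ≤ forrelation f g → False :=
  fun f g hf hg u' hu' hodd hΦ => tw19_levelFive_932_false f g hf hg u' (fun x => (hu' x).trans (by norm_num)) hodd (by linarith)

end Summit.QuantumAdvantage.QuantumAdvantage.Theorems.CubicForrelation.NearExactIsExact

end
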